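import Summits.CriticalPhenomena.Ising3DConformalLimit.Theses.ArmHyperscaling
import Literature.Probability.LatticeModels.IsingMonotonicity
import Literature.Probability.LatticeModels.GKSInequalities

/-!
# Vocabulary of line `mirror-face-saturation` for crux `ArmHyperscaling.OneArmHyperscaling`
(item stmt-CriticalPhenomena-15591, route `ArmHyperscaling`, sub-problem `CriticalPhenomena/Ising3DConformalLimit`)

This is the **definitions module** of the checked skeleton
`Cruxes/OneArmHyperscaling/Lines/mirror_face_saturation.lean` (strategist
planner-cstrat-stmt-CriticalPhenomena-15591-b1-0; lead prover-line-stmt-CriticalPhenomena-15591-0;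
`ledger skeleton check` OK, seven registered stubs `stub_mirrorCauchySchwarz`, `stub_plusMagSubmodular`,
`stub_boxMagMarkov`, `stub_faceGeometry`, `stub_faceSymmetry`, `stub_faceLimit`, `stub_faceSaturation`).
It carries, sorry-free and assertion-free, the skeleton's VOCABULARY over existing Literature declarations —
the evaluation site `x_n = n e₀`, the exterior `−e₀` face `facePatch` of the plus box `x_n + Λ_{Kn}` and its
mirror image `mirrorPatch` in the site plane `{y₀ = 0}`, the critical state `critExpect`, the face-conditioned
magnetisation `faceMag`, the linear response `faceResponse`, the mirror Gram sum `mirrorGram`, the crux's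
left-hand side `plusBoxMag`, the six faces `face`, the symmetry translations `faceShift`, the frozen-set
magnetisations `frozenMag`/`frozenMagShift` — and the line's statements as `def … : Prop`
(`MirrorCauchySchwarz`, `FaceSubadditivity`, `FaceSaturation`, `PlusMagSubmodular`, `BoxMagMarkov`,
`FaceGeometry`, `FaceSymmetry`, `FaceLimit`), so that the stub helper files
`Theorems/ArmHyperscalingOneArmHyperscaling<StubName>.lean` (each proving `theorem <stubName> : <Statement>`
by name, `--supports stmt-CriticalPhenomena-15591`) and the closing skeleton share ONE copy of every object.
NOTHING here is asserted: every `def … : Prop` is a statement to be proved by a registered stub or refuted;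
the one theorem is the registered glue sub-goal `plusBoxMag_nonneg` (GKS I), used by the skeleton's
`faceSubadditivity_of`.

The line in one paragraph.  The crux `(m⁺_{Kn})² ≤ C ⟨σ₀σ_{2ne₀}⟩_{β_c}` on `ℤ³` is reduced to ONE one-scale
inequality about one planar patch in the critical state: reflection positivity in the site mirror `{y₀ = 0}`
(Fröhlich–Israel–Lieb–Simon 1978; tree `CriticalCorrNineMirrorRP_holds`) gives the mirror Cauchy–Schwarz
inequality `T² ≤ ⟨σ₀σ_{2ne₀}⟩ · S` for the response `T = Σ_{y ∈ θA} ⟨σ_xσ_y⟩` and the Gram sum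
`S = Σ_{A × θA} ⟨σ_yσ_{y'}⟩` of the face `θA = facePatch K n`; the spatial Markov property and the GHS
inequality make the centre magnetisation of the plus box subadditive over its six faces, `0 ≤ m⁺_{Kn} ≤ 6F`
with `F = faceMag K n`; the open core is the face-saturation inequality `F ≤ C · T/√S` (sharp in `d = 3` by
scaling, false for `d > 4` like the crux).  Composition (in the skeleton): `m⁺² ≤ 36F² ≤ 36C²T²/S ≤ 36C²⟨σ₀σ_{2ne₀}⟩`.

Sources: J. Fröhlich, R. Israel, E. H. Lieb, B. Simon, Comm. Math. Phys. 62 (1978) 1–34 (reflection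
positivity); R. B. Griffiths, C. A. Hurst, S. Sherman, J. Math. Phys. 11 (1970) 790 and J. L. Lebowitz,
Comm. Math. Phys. 35 (1974) 87 (GHS); S. Friedli, Y. Velenik, *Statistical Mechanics of Lattice Systems*
(CUP 2017), §3.6.3 eq. (3.26) (spatial Markov property), Thm. 3.17 (plus state), §3.10; R. Panis,
arXiv:2406.15243 §1.4.1 (status of one-arm bounds in `d ≥ 3`).
-/

noncomputable section

namespace Summit.CriticalPhenomena.Ising3DConformalLimit.Cruxes.OneArmHyperscaling.MirrorFaceSaturation

open Literature.Probability.LatticeModels Finset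

/-! ### Vocabulary -/

/-- The evaluation site `x_n = n e₀`. -/
def evalSite (n : ℕ) : Site 3 := Pi.single 0 (n : ℤ)

/-- The exterior `−e₀` face of the plus box `Λ_{Kn} + n e₀`: the planar patch
`{y : y₀ = n − Kn − 1, |y₁| ≤ Kn, |y₂| ≤ Kn}` (it lies in the half-space `{y₀ < 0}` for `K ≥ 2`). -/
def facePatch (K n : ℕ) : Finset (Site 3) :=
  Fintype.piFinset fun i : Fin 3 =>
    if i = 0 then ({(n : ℤ) - ((K * n : ℕ) : ℤ) - 1} : Finset ℤ)
    else Finset.Icc (-((K * n : ℕ) : ℤ)) ((K * n : ℕ) : ℤ)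

/-- The mirror image of `facePatch K n` in the site plane `{y₀ = 0}`:
`{y : y₀ = Kn + 1 − n, |y₁| ≤ Kn, |y₂| ≤ Kn}` (in the half-space `{y₀ > 0}`, like `evalSite n`). -/
def mirrorPatch (K n : ℕ) : Finset (Site 3) :=
  Fintype.piFinset fun i : Fin 3 =>
    if i = 0 then ({((K * n : ℕ) : ℤ) + 1 - (n : ℤ)} : Finset ℤ)
    else Finset.Icc (-((K * n : ℕ) : ℤ)) ((K * n : ℕ) : ℤ)

/-- The critical state of the nearest-neighbour Ising model on `ℤ³`, `⟨F⟩_{β_c(3)}` (the plus state at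
`β_c`, `h = 0`; the unique infinite-volume Gibbs measure at `β_c(3)`). -/
def critExpect (F : SpinConfig (Site 3) → ℝ) : ℝ :=
  plusExpect 3 (criticalBeta 3) 0 F

/-- **Face-conditioned magnetisation** `F_{K,n} = ⟨σ_{x_n} | σ ≡ +1 on facePatch K n⟩_{β_c}`, written as the
ratio `⟨σ_x 𝟙_{θA⁺}⟩ / ⟨𝟙_{θA⁺}⟩` with `𝟙_{θA⁺} = plusIndicator (facePatch K n)`. -/
def faceMag (K n : ℕ) : ℝ :=
  critExpect (fun σ => spinAt (evalSite n) σ * plusIndicator (facePatch K n) σ) /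
    critExpect (plusIndicator (facePatch K n))

/-- **Linear response of `σ_x` to the face**: `T_{K,n} = ∑_{y ∈ facePatch K n} ⟨σ_{x_n} σ_y⟩_{β_c}`
(the `h`-derivative at `h = 0` of the magnetisation at `x_n` under a field `h` on the face). -/
def faceResponse (K n : ℕ) : ℝ :=
  ∑ y ∈ facePatch K n, criticalCorr 3 2 ![evalSite n, y]

/-- **Mirror Gram sum** `S_{K,n} = ∑_{y ∈ mirrorPatch K n} ∑_{y' ∈ facePatch K n} ⟨σ_y σ_{y'}⟩_{β_c}` (the OS
square norm `⟨M_A · θM_A⟩` of the patch magnetisation `M_A`, `A = mirrorPatch K n`). -/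
def mirrorGram (K n : ℕ) : ℝ :=
  ∑ y ∈ mirrorPatch K n, ∑ y' ∈ facePatch K n, criticalCorr 3 2 ![y, y']

/-- The crux's left-hand side: the plus-boundary magnetisation at the centre of `Λ_{Kn}` at `β_c(3)`. -/
def plusBoxMag (K n : ℕ) : ℝ :=
  isingCorr (zdGraph 3) (box 3 (K * n)) (criticalBeta 3) 0 BoundaryCondition.plus ({0} : Finset (Site 3))

/-! ### The three statements of the line (strategist) -/

/-- **(MCS) mirror Cauchy–Schwarz.**  Reflection positivity of the critical state in the site mirror
`{y₀ = 0}` (limit of the finite-volume RP of Fröhlich–Israel–Lieb–Simon along symmetric boxes), applied to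
the pair `(σ_{x_n}, M_A)` of observables supported in `{y₀ > 0}`, and translation/reflection invariance
`⟨σ_{ne₀} σ_{−ne₀}⟩ = ⟨σ₀ σ_{2ne₀}⟩`:  `T_{K,n}² ≤ ⟨σ₀σ_{2ne₀}⟩_{β_c} · S_{K,n}`. -/
def MirrorCauchySchwarz : Prop :=
  ∀ K n : ℕ, 2 ≤ K → 1 ≤ n →
    faceResponse K n ^ 2 ≤ criticalTwoPoint 3 (Pi.single 0 (2 * (n : ℤ))) * mirrorGram K n

/-- **(FSA) face subadditivity.**  `0 ≤ m⁺_{Kn} ≤ 6 F_{K,n}`: the plus state of `Λ_{Kn} + n e₀` is the critical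
state conditioned on the six (disjoint) exterior faces being plus (DLR / Markov property of the
nearest-neighbour specification); the magnetisation at the centre is subadditive in the face
conditionings (GHS: `∂²⟨σ_x⟩/∂h_u ∂h_v ≤ 0` for non-negative fields, i.e. decreasing increments, then fields
`→ +∞`), the six face terms are equal by the lattice symmetries fixing `x_n`, and `m⁺ ≥ 0` (GKS). -/
def FaceSubadditivity : Prop :=
  ∀ K n : ℕ, 2 ≤ K → 1 ≤ n → 0 ≤ plusBoxMag K n ∧ plusBoxMag K n ≤ 6 * faceMag K n

/-- **(SAT) the face-saturation inequality — OPEN CORE.**  For some ratio `K ≥ 2` and constant `C`: the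
magnetisation radiated to `x_n` by the fully plus face is at most `C` times the OS-normalised linear
response, `F_{K,n} ≤ C · T_{K,n} / √S_{K,n}` for all `n ≥ 1`.  Sharp (both sides `≍ (Kn)^{-Δσ}`) in `d = 3`
by scaling theory; FALSE for `d > 4` (left `≍ ℓ^{-1}`, right `≍ ℓ^{1-d/2}`): this is where the crux's
hyperscaling content lives. -/
def FaceSaturation : Prop :=
  ∃ K : ℕ, 2 ≤ K ∧ ∃ C : ℝ, ∀ n : ℕ, 1 ≤ n →
    faceMag K n ≤ C * faceResponse K n / Real.sqrt (mirrorGram K n)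

/-! ### Vocabulary for the face-subadditivity reduction (lead's reshape)

Write `x = evalSite n = n e₀`, `m = K n`, `B = x + Λ_m` (so `plusBoxMag K n = ⟨σ_x⟩⁺_B` by translation).
The exterior vertex boundary of `B` in `ℤ³` is the disjoint union of its six faces
`face K n i`, `i : Fin 6` (order `−e₀, +e₀, −e₁, +e₁, −e₂, +e₂`; `face K n 0` is `facePatch K n`
verbatim).  For each face there is a lattice isometry `g_i` FIXING `x` with `g_i (face K n i) = facePatch K n`
and `g_i (Λ_L) = Λ_L + faceShift n i` for every centred box `Λ_L`:
`g₀ = id`; `g₁ y = (2n − y₀, y₁, y₂)`; `g₂ y = (y₁ + n, y₀ − n, y₂)`; `g₃ y = (n − y₁, y₀ − n, y₂)`;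
`g₄ y = (y₂ + n, y₁, y₀ − n)`; `g₅ y = (n − y₂, y₁, y₀ − n)`. -/

/-- The six exterior faces of the translated plus box `evalSite n + box 3 (K n)`, indexed
`0 ↦ −e₀` (this is `facePatch K n`), `1 ↦ +e₀`, `2 ↦ −e₁`, `3 ↦ +e₁`, `4 ↦ −e₂`, `5 ↦ +e₂`. -/
def face (K n : ℕ) (i : Fin 6) : Finset (Site 3) :=
  match i with
  | 0 => facePatch K n
  | 1 => Fintype.piFinset fun j : Fin 3 =>
      if j = 0 then ({(n : ℤ) + ((K * n : ℕ) : ℤ) + 1} : Finset ℤ)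
      else Finset.Icc (-((K * n : ℕ) : ℤ)) ((K * n : ℕ) : ℤ)
  | 2 => Fintype.piFinset fun j : Fin 3 =>
      if j = 0 then Finset.Icc ((n : ℤ) - ((K * n : ℕ) : ℤ)) ((n : ℤ) + ((K * n : ℕ) : ℤ))
      else if j = 1 then ({-((K * n : ℕ) : ℤ) - 1} : Finset ℤ)
      else Finset.Icc (-((K * n : ℕ) : ℤ)) ((K * n : ℕ) : ℤ)
  | 3 => Fintype.piFinset fun j : Fin 3 =>
      if j = 0 then Finset.Icc ((n : ℤ) - ((K * n : ℕ) : ℤ)) ((n : ℤ) + ((K * n : ℕ) : ℤ))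
      else if j = 1 then ({((K * n : ℕ) : ℤ) + 1} : Finset ℤ)
      else Finset.Icc (-((K * n : ℕ) : ℤ)) ((K * n : ℕ) : ℤ)
  | 4 => Fintype.piFinset fun j : Fin 3 =>
      if j = 0 then Finset.Icc ((n : ℤ) - ((K * n : ℕ) : ℤ)) ((n : ℤ) + ((K * n : ℕ) : ℤ))
      else if j = 1 then Finset.Icc (-((K * n : ℕ) : ℤ)) ((K * n : ℕ) : ℤ)
      else ({-((K * n : ℕ) : ℤ) - 1} : Finset ℤ)
  | 5 => Fintype.piFinset fun j : Fin 3 =>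
      if j = 0 then Finset.Icc ((n : ℤ) - ((K * n : ℕ) : ℤ)) ((n : ℤ) + ((K * n : ℕ) : ℤ))
      else if j = 1 then Finset.Icc (-((K * n : ℕ) : ℤ)) ((K * n : ℕ) : ℤ)
      else ({((K * n : ℕ) : ℤ) + 1} : Finset ℤ)

/-- The translation part `v_i` of the lattice isometry `g_i` that fixes `evalSite n` and carries
`face K n i` onto `facePatch K n`; `g_i (box 3 L) = box 3 L + v_i`. -/
def faceShift (n : ℕ) (i : Fin 6) : Site 3 :=
  match i with
  | 0 => 0
  | 1 => ![2 * (n : ℤ), 0, 0]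
  | 2 => ![(n : ℤ), -(n : ℤ), 0]
  | 3 => ![(n : ℤ), -(n : ℤ), 0]
  | 4 => ![(n : ℤ), 0, -(n : ℤ)]
  | 5 => ![(n : ℤ), 0, -(n : ℤ)]

/-- The plus magnetisation at `evalSite n` in the centred box `Λ_L` with the set `E` frozen to `+1`
(i.e. removed from the volume under the `+` boundary condition), at `β_c(3)`, `h = 0`. -/
def frozenMag (n L : ℕ) (E : Finset (Site 3)) : ℝ :=
  isingExpect (zdGraph 3) (box 3 L \ E) (criticalBeta 3) 0 BoundaryCondition.plus (spinAt (evalSite n))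

/-- The same with the box translated by `v`: `⟨σ_{x_n}⟩⁺_{(Λ_L + v) ∖ E; β_c, 0}`. -/
def frozenMagShift (n L : ℕ) (v : Site 3) (E : Finset (Site 3)) : ℝ :=
  isingExpect (zdGraph 3) ((box 3 L).map (Site.shift v).toEmbedding \ E) (criticalBeta 3) 0
    BoundaryCondition.plus (spinAt (evalSite n))

/-- **(SUB) discrete GHS submodularity of the plus magnetisation in the frozen set** (all `β, h ≥ 0`, any
finite volume of `ℤ³`): freezing a further disjoint set `E_i ∌ x` to `+1` raises `⟨σ_x⟩⁺` by LESS the more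
is already frozen, hence `⟨σ_x⟩⁺_{Λ∖⋃E} + m·⟨σ_x⟩⁺_Λ ≤ Σ_i ⟨σ_x⟩⁺_{Λ∖E_i} + ⟨σ_x⟩⁺_Λ` for `m` pairwise
disjoint frozen sets.  One site at a time this is `isingExpect_plus_cond` (spatial Markov property,
Friedli–Velenik eq. (3.26)) + `isingTrunc_plus_mono_volume` (GHS, Lebowitz 1974) +
`isingCorr_plus_le_of_subset` (GKS) + `⟨σ_x;σ_z⟩⁺ ≥ 0` (FKG/GKS II). -/
def PlusMagSubmodular : Prop :=
  ∀ (β h : ℝ), 0 ≤ β → 0 ≤ h → ∀ (Λ : Finset (Site 3)) (x : Site 3) (m : ℕ)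
    (E : Fin m → Finset (Site 3)), x ∈ Λ → (∀ i, x ∉ E i) → (∀ i, E i ⊆ Λ) →
    (∀ i j, i ≠ j → Disjoint (E i) (E j)) →
    isingExpect (zdGraph 3) (Λ \ Finset.univ.biUnion E) β h BoundaryCondition.plus (spinAt x) +
        (m : ℝ) * isingExpect (zdGraph 3) Λ β h BoundaryCondition.plus (spinAt x) ≤
      (∑ i, isingExpect (zdGraph 3) (Λ \ E i) β h BoundaryCondition.plus (spinAt x)) +
        isingExpect (zdGraph 3) Λ β h BoundaryCondition.plus (spinAt x)

/-- **(MKV) the plus box is the big box with its six faces frozen**: for `K n + n + 1 ≤ L`,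
`plusBoxMag K n = ⟨σ_{x_n}⟩⁺_{Λ_L ∖ ⋃_i face K n i}` (translation covariance `isingExpect_plus_shift` +
domain Markov `isingExpect_fixed_eq_of_separated`: no edge of `ℤ³` joins `x_n + Λ_{Kn}` to the rest of
`Λ_L` minus the faces). -/
def BoxMagMarkov : Prop :=
  ∀ K n L : ℕ, K * n + n + 1 ≤ L →
    plusBoxMag K n = frozenMag n L (Finset.univ.biUnion (face K n))

/-- **(GEO) face geometry**: for `K n + n + 1 ≤ L` the centre `x_n` lies in `Λ_L` and on no face, the six
faces lie in `Λ_L` and are pairwise disjoint (linear integer arithmetic on coordinates). -/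
def FaceGeometry : Prop :=
  ∀ K n L : ℕ, K * n + n + 1 ≤ L →
    evalSite n ∈ box 3 L ∧ (∀ i, evalSite n ∉ face K n i) ∧ (∀ i, face K n i ⊆ box 3 L) ∧
      (∀ i j, i ≠ j → Disjoint (face K n i) (face K n j))

/-- **(SYM) lattice symmetry of the six face terms**: `⟨σ_{x_n}⟩⁺_{Λ_L ∖ face_i} = ⟨σ_{x_n}⟩⁺_{(Λ_L + v_i) ∖ facePatch}`
(`isingExpect_fixed_relabel` along the graph automorphism `g_i` of `ℤ³`, which fixes `x_n` and the
constant `+` boundary condition, maps `face K n i` onto `facePatch K n` and `Λ_L` onto `Λ_L + faceShift n i`). -/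
def FaceSymmetry : Prop :=
  ∀ (K n L : ℕ) (i : Fin 6), frozenMag n L (face K n i) = frozenMagShift n L (faceShift n i) (facePatch K n)

/-- **(LIM) the face-frozen magnetisation converges to `faceMag` along translated boxes**:
`⟨σ_{x_n}⟩⁺_{(Λ_L + v) ∖ facePatch} → faceMag K n` as `L → ∞`, for every `v` (spatial Markov property
`fieldExpect_fixed_eq_cond`: for `facePatch ⊆ Λ_L + v` the left side is
`⟨σ_x 𝟙_{θA⁺}⟩⁺_{Λ_L+v} / ⟨𝟙_{θA⁺}⟩⁺_{Λ_L+v}` with `σ_x 𝟙_{θA⁺} = 2·𝟙_{(θA ∪ {x})⁺} − 𝟙_{θA⁺}`; then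
`tendsto_isingExpect_plus_plusIndicator_comp_shift` for numerator and denominator, the latter with limit
`≥ 2^{-|θA|} > 0` by FKG, and `plusExpect = limUnder` of a convergent sequence). -/
def FaceLimit : Prop :=
  ∀ (K n : ℕ) (v : Site 3),
    Filter.Tendsto (fun L : ℕ => frozenMagShift n L v (facePatch K n)) Filter.atTop (nhds (faceMag K n))

/-! ### Registered glue sub-goal -/

/-- `0 ≤ plusBoxMag K n`: the plus-box magnetisation at `β_c(3) ≥ 0`, `h = 0` is non-negative (first Griffiths
inequality, tree `GKSInequalities.gks_one_holds`; Friedli–Velenik 2017, Thm. 3.20, eq. (3.21)). Registered glue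
sub-goal of the skeleton (`faceSubadditivity_of` uses it for the lower clause of `FaceSubadditivity`). -/
theorem plusBoxMag_nonneg : ∀ K n : ℕ, 0 ≤ plusBoxMag K n := fun K n =>
  GKSInequalities.gks_one_holds (zdGraph 3) (criticalBeta_nonneg 3) le_rfl (Or.inr rfl)
    (Finset.singleton_subset_iff.2 (zero_mem_box 3 (K * n)))

/-! ### Alternative open core (lead, 2026-08-17): bounded Casimir overlap of the two mirror patches

Reflection positivity with the INDICATOR `𝟙_{A⁺}` of the mirror patch `A = mirrorPatch K n` as test observable (instead of
its magnetisation `M_A`) gives `⟨σ_x 𝟙_{θA⁺}⟩² ≤ ⟨σ_x σ_{θx}⟩ · ⟨𝟙_{A⁺} 𝟙_{θA⁺}⟩`, i.e.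
`(F · P(θA⁺))² ≤ ⟨σ₀σ_{2ne₀}⟩ · P(A⁺ ∩ θA⁺)` with `θA = facePatch K n`, `F = faceMag K n`, and `P(A⁺) = P(θA⁺)` by
reflection invariance; so the crux follows from `FaceSubadditivity` (landed, `faceSubadditivity_proof`) and the
bound `P(A⁺ ∩ θA⁺) ≤ C · P(A⁺) · P(θA⁺)` ALONE — a one-scale statement about two facing fully-plus patches of half-width
`Kn` at distance `2((K−1)n+1)` in the critical state: their critical Casimir interaction free energy
`−log (P(A⁺∩θA⁺)/P(A⁺)P(θA⁺)) ≥ 0` (FKG) stays BOUNDED as `n → ∞` at fixed `K`.  Scaling: `≍ (Kn)²/dist² = O(1)` in `d = 3`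
(hyperscaling form of the Casimir energy), growing like `ℓ^{d−4}` in mean field, so it fails for `d > 4` exactly like the crux. -/

/-- **(CAS) bounded Casimir overlap — ALTERNATIVE OPEN CORE.**  For some ratio `K ≥ 2` and constant `C`: for all `n ≥ 1`,
`⟨𝟙_{A⁺} · 𝟙_{θA⁺}⟩_{β_c} ≤ C · ⟨𝟙_{A⁺}⟩_{β_c} · ⟨𝟙_{θA⁺}⟩_{β_c}` with `A = mirrorPatch K n`, `θA = facePatch K n`,
`𝟙_{B⁺} = plusIndicator B` and `⟨·⟩_{β_c} = critExpect` (the probability that both mirror patches are entirely plus is at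
most a constant times the product of the single-patch probabilities).  Nothing is claimed: a statement to be proved or refuted. -/
def CasimirBound : Prop :=
  ∃ K : ℕ, 2 ≤ K ∧ ∃ C : ℝ, ∀ n : ℕ, 1 ≤ n →
    critExpect (fun σ => plusIndicator (mirrorPatch K n) σ * plusIndicator (facePatch K n) σ) ≤
      C * (critExpect (plusIndicator (mirrorPatch K n)) * critExpect (plusIndicator (facePatch K n)))

/-- `face K n 0` is `facePatch K n` (definitional; registered glue sub-goal used when the six faces are enumerated). -/
theorem face_zero : ∀ K n : ℕ, face K n 0 = facePatch K n := fun _ _ => rfl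

end Summit.CriticalPhenomena.Ising3DConformalLimit.Cruxes.OneArmHyperscaling.MirrorFaceSaturation

end
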